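import Literature.Probability.Percolation.QuadCrossingContinuityCaseOne
import Literature.Probability.Percolation.QuadCrossingContinuityCaseTwoTame3All
import Literature.Probability.Percolation.QuadCrossingContinuityCaseThreeSmall
import Literature.Probability.Percolation.QuadCrossingContinuityCaseThreeSmallOne
import HarnessLib

/-!
# Schramm–Smirnov Lemma 6.1 for tame pairs: the proved part of the named fact, in its own format

Topic `Probability/Percolation`; proofs file towards the named fact `SchrammSmirnov2011_lemma_6_1`
(`QuadCrossingContinuity.lean`; O. Schramm, S. Smirnov, *On the scaling limits of planar
percolation*, Ann. Probab. 39 (2011) 1768–1814, arXiv:1101.5820, Lemma 6.1 and its proof,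
pp. 21–23).

The named fact asserts, for critical bond percolation on `δℤ²` and ALL topological quads, a bound
`μ_η(⊞_Q Δ ⊞_{Q'}) < Δ_c(δ, d(Q))` with `Δ_c(δ, d) → 0` as `δ → 0`, whenever `(Q, Q')` satisfies one
of the perturbation conditions (1), (2), (3) at scale `δ < d(Q)/2`.  This file assembles what the
tree proves of it into ONE statement of exactly that shape,
`SchrammSmirnov2011_lemma_6_1_tame`, valid for the pairs covered so far:

* condition (1) — all quads (`real_symmDiff_crossedEvent_le_of_isPerturbationOne`);
* condition (2) — pairs with `[Q]` lattice-tame at the meshes in play (every edge segment of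
  `η√2 · ℤ²`, `η < δ`, meets `[Q]` in a connected set), `∂₂Q'` chord–arc at scale `δ` with a fixed
  constant `K ≥ 1`, and `[Q']` locally star-shaped at the points of `∂₂Q'`
  (`real_symmDiff_crossedEvent_le_of_isPerturbationTwo_of_tame₃_all`; no cut point);
* condition (3) — pairs whose big quad is thin in one direction, `d₀(Q) ≤ δ` or `d₁(Q) ≤ δ`
  (`…_of_isPerturbationThree_of_sideDist_zero_le`, `…_of_isPerturbationThree_of_sideDist_one_le`).

The soft envelope step is `exists_envelope_of_bound` (the argument of
`SchrammSmirnov2011_lemma_6_1_of_bound` for an arbitrary class of pairs).  What is NOT covered, and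
keeps the named fact open in the tree: condition (2) for quads with sub-mesh exterior pockets (the
printed decoupling "the restriction of `ω` to `[Q] ∖ M` is unbiased" fails there) or without the
chord–arc / star-shapedness provisos, and condition (3) beyond the thin regimes (the dual twin of the
lowest-crossing exploration).  Everything here is proved; no named fact is introduced.

## References

* O. Schramm, S. Smirnov, Ann. Probab. 39 (2011) 1768–1814, arXiv:1101.5820, Lemma 6.1 and its
  proof. [SchrammSmirnov2011]
-/

noncomputable section

open Set Metric Filter Function
open _root_.MeasureTheory _root_.Topology
open scoped ENNReal symmDiff
open Literature.Probability.LatticeModels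
open Literature.Topology.PlaneTopology

namespace Literature.Probability.Percolation

namespace QuadCrossing

variable {D : Set ℂ}

/-! ### The envelope, for an arbitrary class of pairs -/

/-- **Envelope reduction for a class of pairs** (the argument of
`SchrammSmirnov2011_lemma_6_1_of_bound`): a scale-free bound `μ_η(⊞_Q Δ ⊞_{Q'}) ≤ F(δ/d(Q))` for
`0 < η < δ ≤ c · d(Q)` on a class `P` of pairs, with `F → 0` at `0⁺`, yields a positive envelope
`Δ_c(δ, d) → 0` (`δ → 0⁺`, `d` fixed) with `μ_η(⊞_Q Δ ⊞_{Q'}) < Δ_c(δ, d(Q))` on the class for ALL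
`δ > 0`. [cite: SchrammSmirnov2011, Lemma 6.1] -/
theorem exists_envelope_of_bound {c : ℝ} (hc : 0 < c) (F : ℝ → ℝ)
    (hF : Tendsto F (𝓝[>] 0) (𝓝 0)) (P : ∀ D : Set ℂ, Quad D → Quad D → ℝ → Prop)
    (hbound : ∀ (D : Set ℂ) (Q Q' : Quad D) (δ : ℝ), 0 < δ → δ ≤ c * Q.sizeParam →
      P D Q Q' δ → ∀ η : ℝ, 0 < η → η < δ →
        (squareCrossingLaw D η : Measure (QuadConfig D)).real
            (symmDiff (QuadConfig.crossedEvent Q) (QuadConfig.crossedEvent Q')) ≤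
          F (δ / Q.sizeParam)) :
    ∃ Δc : ℝ → ℝ → ℝ,
      (∀ δ d : ℝ, 0 < δ → 0 < d → 0 < Δc δ d) ∧
      (∀ d : ℝ, 0 < d → Tendsto (fun δ => Δc δ d) (𝓝[>] 0) (𝓝 0)) ∧
      ∀ (D : Set ℂ) (Q Q' : Quad D) (δ : ℝ), 0 < δ → P D Q Q' δ →
        ∀ η : ℝ, 0 < η → η < δ →
          (squareCrossingLaw D η : Measure (QuadConfig D)).real
              (symmDiff (QuadConfig.crossedEvent Q) (QuadConfig.crossedEvent Q')) <
            Δc δ Q.sizeParam := by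
  refine ⟨fun δ d => |F (δ / d)| + δ / d + 2 * δ / (c * d), ?_, ?_, ?_⟩
  · -- positivity
    intro δ d hδ hd
    have h1 : 0 ≤ |F (δ / d)| := abs_nonneg _
    have h2 : 0 < δ / d := div_pos hδ hd
    have h3 : 0 ≤ 2 * δ / (c * d) := by positivity
    linarith
  · -- the limit `δ → 0⁺` for fixed `d > 0`
    intro d hd
    have hdiv : Tendsto (fun δ : ℝ => δ / d) (𝓝[>] 0) (𝓝[>] 0) := by
      refine tendsto_nhdsWithin_iff.2 ⟨?_, ?_⟩
      · have : Tendsto (fun δ : ℝ => δ / d) (𝓝 0) (𝓝 (0 / d)) :=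
          (continuous_id.div_const d).tendsto 0
        rw [zero_div] at this
        exact this.mono_left nhdsWithin_le_nhds
      · filter_upwards [self_mem_nhdsWithin] with δ hδ
        exact div_pos hδ hd
    have hA : Tendsto (fun δ : ℝ => |F (δ / d)|) (𝓝[>] 0) (𝓝 0) := by
      simpa using (hF.comp hdiv).abs
    have hB : Tendsto (fun δ : ℝ => δ / d) (𝓝[>] 0) (𝓝 0) :=
      (tendsto_nhdsWithin_iff.1 hdiv).1
    have hC : Tendsto (fun δ : ℝ => 2 * δ / (c * d)) (𝓝[>] 0) (𝓝 0) := by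
      have : Tendsto (fun δ : ℝ => 2 * δ / (c * d)) (𝓝 0) (𝓝 (2 * 0 / (c * d))) :=
        ((continuous_const.mul continuous_id).div_const (c * d)).tendsto 0
      rw [mul_zero, zero_div] at this
      exact this.mono_left nhdsWithin_le_nhds
    simpa using (hA.add hB).add hC
  · -- the estimate
    intro D Q Q' δ hδ hcond η hη hηδ
    have hd : 0 < Q.sizeParam := Q.sizeParam_pos
    set d := Q.sizeParam with hd_def
    have h2 : 0 < δ / d := div_pos hδ hd
    have h3 : 0 ≤ 2 * δ / (c * d) := by positivity
    by_cases hcase : δ ≤ c * d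
    · have := hbound D Q Q' δ hδ hcase hcond η hη hηδ
      have habs : F (δ / d) ≤ |F (δ / d)| := le_abs_self _
      linarith
    · push Not at hcase
      have hP := real_squareCrossingLaw_le_one D η
        (symmDiff (QuadConfig.crossedEvent Q) (QuadConfig.crossedEvent Q'))
      have hbig : 2 < 2 * δ / (c * d) := by
        rw [lt_div_iff₀ (mul_pos hc hd)]
        nlinarith
      have h1 : 0 ≤ |F (δ / d)| := abs_nonneg _
      linarith

/-- `t ↦ (C t)^α → 0` as `t → 0⁺` (`α > 0`). [folklore] -/
theorem tendsto_const_mul_rpow_nhdsWithin_zero (C : ℝ) {α : ℝ} (hα : 0 < α) :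
    Tendsto (fun t : ℝ => (C * t) ^ α) (𝓝[>] 0) (𝓝 0) := by
  have hcont : ContinuousAt (fun t : ℝ => (C * t) ^ α) 0 := by
    have h1 : ContinuousAt (fun t : ℝ => C * t) 0 := (continuous_const.mul continuous_id).continuousAt
    exact ContinuousAt.rpow_const (f := fun t : ℝ => C * t) h1 (Or.inr hα.le)
  have := hcont.tendsto
  rw [mul_zero, Real.zero_rpow hα.ne'] at this
  exact this.mono_left nhdsWithin_le_nhds

/-! ### Lemma 6.1 for tame pairs -/

/-- **Schramm–Smirnov Lemma 6.1 for the pairs covered by the tree** (see the module docstring), in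
the format of the named fact `SchrammSmirnov2011_lemma_6_1`: for every chord–arc constant `K ≥ 1`
there is a positive `Δ_c(δ, d)`, tending to `0` as `δ → 0` for fixed `d`, such that
`μ_η(⊞_Q Δ ⊞_{Q'}) < Δ_c(δ, d(Q))` for all `0 < η < δ`, whenever `(Q, Q')` satisfies condition (1),
or condition (2) together with lattice tameness of `[Q]` at the meshes `η√2` (`η < δ`), the
`K`-chord–arc property of `∂₂Q'` at scale `δ` and local star-shapedness of `[Q']` at the points of
`∂₂Q'`, or condition (3) together with `d₀(Q) ≤ δ` or `d₁(Q) ≤ δ`.  (The hypothesis `δ < d(Q)/2`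
of the printed statement is not needed for these cases.)
[cite: SchrammSmirnov2011, Lemma 6.1 and its proof, pp. 21–23] -/
theorem SchrammSmirnov2011_lemma_6_1_tame {K : ℝ} (hK : 1 ≤ K) :
    ∃ Δc : ℝ → ℝ → ℝ,
      (∀ δ d : ℝ, 0 < δ → 0 < d → 0 < Δc δ d) ∧
      (∀ d : ℝ, 0 < d → Tendsto (fun δ => Δc δ d) (𝓝[>] 0) (𝓝 0)) ∧
      ∀ (D : Set ℂ) (Q Q' : Quad D) (δ : ℝ), 0 < δ →
        (Q.IsPerturbationOne Q' δ ∨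
          (Q.IsPerturbationTwo Q' δ ∧
            (∀ η : ℝ, 0 < η → η < δ → ∀ a b : Site 2, (zdGraph 2).Adj a b →
              IsPreconnected (segment ℝ (meshPoint (η * Real.sqrt 2) a)
                (meshPoint (η * Real.sqrt 2) b) ∩ Q.carrier)) ∧
            (∀ s t : unitInterval, dist (Q' (1, s)) (Q' (1, t)) ≤ δ → ∀ u : unitInterval,
              ((s : ℝ) ≤ u ∧ (u : ℝ) ≤ t ∨ (t : ℝ) ≤ u ∧ (u : ℝ) ≤ s) →
                dist (Q' (1, u)) (Q' (1, s)) ≤ K * δ) ∧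
            (∀ x ∈ Q'.side 2, ∃ r > 0, ∀ u ∈ Q'.carrier, u ∈ ball x r →
              segment ℝ x u ⊆ Q'.carrier)) ∨
          (Q.IsPerturbationThree Q' δ ∧ (Q.sideDist 0 ≤ δ ∨ Q.sideDist 1 ≤ δ))) →
        ∀ η : ℝ, 0 < η → η < δ →
          (squareCrossingLaw D η : Measure (QuadConfig D)).real
              (symmDiff (QuadConfig.crossedEvent Q) (QuadConfig.crossedEvent Q')) <
            Δc δ Q.sizeParam := by
  -- the four ingredients
  obtain ⟨α₁, C₁, c₁, hα₁, hC₁, hc₁, h1⟩ := real_symmDiff_crossedEvent_le_of_isPerturbationOne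
  obtain ⟨α₂, C₂, c₂, hα₂, hC₂, hc₂, h2⟩ :=
    real_symmDiff_crossedEvent_le_of_isPerturbationTwo_of_tame₃_all
  obtain ⟨α₃, C₃, c₃, hα₃, hC₃, hc₃, h3⟩ :=
    real_symmDiff_crossedEvent_le_of_isPerturbationThree_of_sideDist_zero_le
  obtain ⟨α₄, C₄, c₄, hα₄, hC₄, hc₄, h4⟩ :=
    real_symmDiff_crossedEvent_le_of_isPerturbationThree_of_sideDist_one_le
  have hKpos : 0 < K := by linarith
  -- the common regime constant and the bound function
  set c : ℝ := min (min c₁ (c₂ / K)) (min (min c₃ c₄) (1 / 2)) with hcdef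
  have hcpos : 0 < c := by
    rw [hcdef]
    exact lt_min (lt_min hc₁ (div_pos hc₂ hKpos)) (lt_min (lt_min hc₃ hc₄) (by norm_num))
  have hcc₁ : c ≤ c₁ := by rw [hcdef]; exact (min_le_left _ _).trans (min_le_left _ _)
  have hcc₂ : c ≤ c₂ / K := by rw [hcdef]; exact (min_le_left _ _).trans (min_le_right _ _)
  have hcc₃ : c ≤ c₃ := by
    rw [hcdef]; exact (min_le_right _ _).trans ((min_le_left _ _).trans (min_le_left _ _))
  have hcc₄ : c ≤ c₄ := by
    rw [hcdef]; exact (min_le_right _ _).trans ((min_le_left _ _).trans (min_le_right _ _))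
  have hchalf : c ≤ 1 / 2 := by rw [hcdef]; exact (min_le_right _ _).trans (min_le_right _ _)
  set F : ℝ → ℝ := fun t =>
    (C₁ * t) ^ α₁ + 3 * (C₂ * K * t) ^ α₂ + (C₃ * t) ^ α₃ + (C₄ * t) ^ α₄ with hFdef
  have hF : Tendsto F (𝓝[>] 0) (𝓝 0) := by
    have t1 := tendsto_const_mul_rpow_nhdsWithin_zero C₁ hα₁
    have t2 := (tendsto_const_mul_rpow_nhdsWithin_zero (C₂ * K) hα₂).const_mul 3
    have t3 := tendsto_const_mul_rpow_nhdsWithin_zero C₃ hα₃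
    have t4 := tendsto_const_mul_rpow_nhdsWithin_zero C₄ hα₄
    rw [mul_zero] at t2
    simpa [hFdef] using ((t1.add t2).add t3).add t4
  -- nonnegativity of the four terms
  have hF₁ : ∀ t, 0 ≤ t → (C₁ * t) ^ α₁ ≤ F t ∧ 3 * (C₂ * K * t) ^ α₂ ≤ F t ∧
      (C₃ * t) ^ α₃ ≤ F t ∧ (C₄ * t) ^ α₄ ≤ F t := by
    intro t ht
    have n1 : 0 ≤ (C₁ * t) ^ α₁ := Real.rpow_nonneg (by positivity) _
    have n2 : 0 ≤ 3 * (C₂ * K * t) ^ α₂ := by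
      have := Real.rpow_nonneg (show 0 ≤ C₂ * K * t by positivity) α₂; positivity
    have n3 : 0 ≤ (C₃ * t) ^ α₃ := Real.rpow_nonneg (by positivity) _
    have n4 : 0 ≤ (C₄ * t) ^ α₄ := Real.rpow_nonneg (by positivity) _
    simp only [hFdef]
    exact ⟨by linarith, by linarith, by linarith, by linarith⟩
  -- the envelope
  refine exists_envelope_of_bound hcpos F hF (fun D Q Q' δ =>
    Q.IsPerturbationOne Q' δ ∨
      (Q.IsPerturbationTwo Q' δ ∧
        (∀ η : ℝ, 0 < η → η < δ → ∀ a b : Site 2, (zdGraph 2).Adj a b →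
          IsPreconnected (segment ℝ (meshPoint (η * Real.sqrt 2) a)
            (meshPoint (η * Real.sqrt 2) b) ∩ Q.carrier)) ∧
        (∀ s t : unitInterval, dist (Q' (1, s)) (Q' (1, t)) ≤ δ → ∀ u : unitInterval,
          ((s : ℝ) ≤ u ∧ (u : ℝ) ≤ t ∨ (t : ℝ) ≤ u ∧ (u : ℝ) ≤ s) →
            dist (Q' (1, u)) (Q' (1, s)) ≤ K * δ) ∧
        (∀ x ∈ Q'.side 2, ∃ r > 0, ∀ u ∈ Q'.carrier, u ∈ ball x r →
          segment ℝ x u ⊆ Q'.carrier)) ∨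
      (Q.IsPerturbationThree Q' δ ∧ (Q.sideDist 0 ≤ δ ∨ Q.sideDist 1 ≤ δ))) ?_
  intro D Q Q' δ hδ hδc hcond η hη hηδ
  have hd : 0 < Q.sizeParam := Q.sizeParam_pos
  have hd₀pos : 0 < Q.sideDist 0 := Q.sideDist_pos 0
  have hd₁pos : 0 < Q.sideDist 1 := Q.sideDist_pos 1
  have hdmax : Q.sizeParam = max (Q.sideDist 0) (Q.sideDist 1) := rfl
  have ht0 : 0 ≤ δ / Q.sizeParam := (div_pos hδ hd).le
  obtain ⟨hb₁, hb₂, hb₃, hb₄⟩ := hF₁ _ ht0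
  have hδd : δ < Q.sizeParam := by
    have : c * Q.sizeParam ≤ (1 / 2) * Q.sizeParam := mul_le_mul_of_nonneg_right hchalf hd.le
    linarith
  rcases hcond with hone | ⟨htwo, htame, harc, hstar⟩ | ⟨hthree, hthin⟩
  · -- condition (1)
    have hδc₁ : δ ≤ c₁ * Q.sizeParam :=
      hδc.trans (mul_le_mul_of_nonneg_right hcc₁ hd.le)
    refine (h1 D Q Q' δ hδ hδc₁ hone η hη hηδ).trans ?_
    have : C₁ * δ / Q.sizeParam = C₁ * (δ / Q.sizeParam) := by ring
    rw [this]; exact hb₁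
  · -- condition (2), tame pair
    have hKδ : K * δ ≤ c₂ * Q.sizeParam := by
      have h' : δ ≤ c₂ / K * Q.sizeParam := hδc.trans (mul_le_mul_of_nonneg_right hcc₂ hd.le)
      have := mul_le_mul_of_nonneg_left h' hKpos.le
      calc K * δ ≤ K * (c₂ / K * Q.sizeParam) := this
        _ = c₂ * Q.sizeParam := by field_simp
    refine (h2 D Q Q' δ K hδ hK hKδ htwo htame harc hstar η hη hηδ).trans ?_
    have : C₂ * K * δ / Q.sizeParam = C₂ * K * (δ / Q.sizeParam) := by ring
    rw [this]; exact hb₂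
  · rcases hthin with hd0 | hd1
    · -- condition (3), `d₀ ≤ δ`: then `d = d₁`
      have hdd₁ : Q.sizeParam = Q.sideDist 1 := by
        rw [hdmax]
        rcases le_total (Q.sideDist 0) (Q.sideDist 1) with h | h
        · exact max_eq_right h
        · exfalso; rw [hdmax, max_eq_left h] at hδd; linarith
      have hδc₃ : δ ≤ c₃ * Q.sideDist 1 := by
        rw [← hdd₁]; exact hδc.trans (mul_le_mul_of_nonneg_right hcc₃ hd.le)
      refine (h3 D Q Q' δ hδ hδc₃ hthree hd0 η hη hηδ).trans ?_
      have : C₃ * δ / Q.sideDist 1 = C₃ * (δ / Q.sizeParam) := by rw [hdd₁]; ring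
      rw [this]; exact hb₃
    · -- condition (3), `d₁ ≤ δ`: then `d = d₀`
      have hdd₀ : Q.sizeParam = Q.sideDist 0 := by
        rw [hdmax]
        rcases le_total (Q.sideDist 1) (Q.sideDist 0) with h | h
        · exact max_eq_left h
        · exfalso; rw [hdmax, max_eq_right h] at hδd; linarith
      have hδc₄ : δ ≤ c₄ * Q.sideDist 0 := by
        rw [← hdd₀]; exact hδc.trans (mul_le_mul_of_nonneg_right hcc₄ hd.le)
      refine (h4 D Q Q' δ hδ hδc₄ hthree hd1 η hη hηδ).trans ?_
      have : C₄ * δ / Q.sideDist 0 = C₄ * (δ / Q.sizeParam) := by rw [hdd₀]; ring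
      rw [this]; exact hb₄

end QuadCrossing

end Literature.Probability.Percolation
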